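import Summits.Schanuel.Schanuel.Theorems.DiophantineDichotomyApproximationPropertyPointAPThreeMid
import Summits.Schanuel.Schanuel.Theorems.DiophantineDichotomyApproximationPropertyLowSurfaceOr
import HarnessLib

/-!
# `PointAPAbsAt 3` and the crux CONDITIONALLY on the MID-LOW satellite kernel only (crux `ApproximationProperty`, stmt-Schanuel-6117) — record of skeleton v26

Crux `stmt-Schanuel-6117` (`Summit.Schanuel.Schanuel.Theses.DiophantineDichotomy.ApproximationProperty`), route
`DiophantineDichotomy`, line `orbit-interpolation-determinant`, lead c12 (`prover-line-stmt-Schanuel-6117-c12-0`,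
skeleton v26, `Cruxes/ApproximationProperty/Lines/orbit_interpolation_determinant.lean`, KERNEL-c12.md §6).

Successor of …PointAPThreeMid.lean (p154747, hypothesis `hmid` = v25's mid stub). What changed: the LOW-SURFACE dichotomy
`pointDatum_or_lowSurface3` (…LowSurfaceOr.lean) is a theorem of the tree — at every `M₁ ≥ 64c₁`, an orbit of the
clause-free descent on an enveloping rank-2 satellite `𝔮'` either yields the datum or `𝔮'` contains an irreducible factor
of a Dirichlet form of degree `≤ Δ/M₁` and height `≤ λY/c₁`. Hence v25's mid stub follows from the MID-LOW stub alone
(`midSatellite3_of_midLow`: boosts multiplied), and so do `PointAPAbsAt 3`, the `t = 3` slice and — with Philippon's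
conjecture for `n ≥ 4` — the crux (`approximationProperty_of_midLow`, registered sub-goal). The hypothesis `hmidLow` is
the registered OPEN stub `pointDatum_of_midLowSatellite3` verbatim: v25's mid stub (far ∧ thin ∧ enveloped ∧ deficient
satellite of degree `δ⋆ < deg 𝔮' < ηΔ²`, long orbit failing the clause) with `M₁ ≥ 64c₁` at the stub's disposal and the
extra hypothesis that the satellite lies on a surface of degree `≤ Δ/M₁` in the above sense — the open content of
Philippon's AP2 at `n = 3` in this line after v26 (KERNEL-c12.md §3, §6).

Sources: Nesterenko–Philippon (eds.), LNM 1752 (2001) Ch. 3 §4 (Prop. 4.11), Ch. 4 §4 p. 61 (AP1/AP2).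
-/

set_option linter.dupNamespace false

noncomputable section

attribute [local instance] MvPolynomial.gradedAlgebra

namespace Summit.Schanuel.Schanuel.Cruxes.ApproximationProperty.OrbitInterpolationDeterminant

open Summit.Schanuel.Schanuel.Theses.DiophantineDichotomy (ApproximationProperty)
open Literature.NumberTheory.Transcendental.Nesterenko MvPolynomial
open scoped BigOperators

open PointAPThreeMid in
/-- **v25's mid stub from the MID-LOW stub** (`midSatellite3_of_midLow`): given the mid-low kernel (hypothesis `hmidLow`
= registered open stub `pointDatum_of_midLowSatellite3` verbatim), v25's mid stub `pointDatum_of_midSatellite3` holds —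
take the mid-low stub's `δ⋆, K₀, C₄, η, M₁`, run the landed `pointDatum_or_lowSurface3` at the height scale `λ_M·Y` and
feed its second branch to the mid-low stub at the height scale `λ_L·Y`. [folklore] -/
theorem midSatellite3_of_midLow (hmidLow : ∀ (ω : Fin 3 → ℂ) (c₁ : ℝ), 1 ≤ c₁ → ∃ δstar : ℕ, 1 ≤ δstar ∧ ∃ K₀ : ℕ, 1 ≤ K₀ ∧ ∃ C₄ : ℝ, c₁ ≤ C₄ ∧ ∃ η : ℝ, 0 < η ∧ ∃ M₁ : ℝ, 64 * c₁ ≤ M₁ ∧ ∃ lam : ℝ, 1 ≤ lam ∧ ∃ c : ℝ, c₁ ≤ c ∧ ∀ Δ Y : ℝ, c ≤ Δ → Δ ≤ Y → ∀ (Q : Rx 3) (a : ℕ) (P : Rx 3) (b : ℕ) (𝔮 : Ideal (Rx 3)) (T : Rx 3) (τ : ℕ) (𝔭 𝔮' : Ideal (Rx 3)), CycleAP3Datum ω c₁ Δ (lam * Y) Q a P b 𝔮 T τ 𝔭 → 𝔮'.IsPrime → 𝔮'.IsHomogeneous (homogeneousSubmodule (Fin (3 + 1)) ℚ) → IsUnmixedOfRank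 𝔮' 2 → 𝔮' ∈ (Ideal.span {Q} ⊔ Ideal.span {P}).minimalPrimes → Ideal.span {Q} ⊔ Ideal.span {P} ⊔ Ideal.span {T} ≤ 𝔮' → 𝔮' < 𝔭 → δstar < ideg 𝔮' 2 → a + b + ⌊Δ⌋₊ ≤ τ → Module.finrank ℚ ↥(homogeneousSubmodule (Fin (3 + 1)) ℚ τ) < Module.finrank ℚ ↥(homogeneousSubmodule (Fin (3 + 1)) ℚ τ ⊓ 𝔮'.restrictScalars ℚ) + 2 * ⌊Δ⌋₊ * ideg 𝔮 2 → ⌊c₁ * Δ⌋₊ + 1 < ideg 𝔭 1 → ¬ (Module.finrank ℚ ↥(homogeneousSubmodule (Fin (3 + 1)) ℚ ⌊c₁ * Δ⌋₊) = Module.finrank ℚ ↥(homogeneousSubmodule (Fin (3 + 1)) ℚ ⌊c₁ * Δ⌋₊ ⊓ 𝔭.restrictScalars ℚ) + ideg 𝔭 1) → homogeneousSubmodule (Fin (3 + 1)) ℚ ⌊C₄ * Δ⌋₊ ⊓ 𝔭.restrictScalars ℚ ≤ 𝔮'.restrictScalars ℚ → K₀ * Module.finrank ℚ ↥(homogeneousSubmodule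 (Fin (3 + 1)) ℚ ⌊C₄ * Δ⌋₊) < ideg 𝔭 1 + K₀ * Module.finrank ℚ ↥(homogeneousSubmodule (Fin (3 + 1)) ℚ ⌊C₄ * Δ⌋₊ ⊓ 𝔭.restrictScalars ℚ) → (ideg 𝔮' 2 : ℝ) < η * Δ ^ 2 → (∃ (F Q₂ : Rx 3) (d a₂ : ℕ), F ≠ 0 ∧ F.IsHomogeneous d ∧ 1 ≤ d ∧ (d : ℝ) ≤ Δ / M₁ ∧ height F ≤ lam * Y / c₁ ∧ Q₂ ≠ 0 ∧ Q₂.IsHomogeneous a₂ ∧ 1 ≤ a₂ ∧ a₂ ≤ d ∧ (Ideal.span {Q₂}).IsPrime ∧ Q₂ ∣ F ∧ Q₂ ∈ 𝔮') → ∃ (K : Type) (_ : Field K) (_ : NumberField K) (β : Fin 3 → K) (σ : K →+* ℂ), (Module.finrank ℚ K : ℝ) ≤ (c * Δ) ^ 3 ∧ Height.logHeight (Fin.cons (1 : K) β : Fin (3 + 1) → K) ≤ c * Y * Δ ^ 2 ∧ ‖(fun j => σ (β j)) - ω‖ ≤ Real.exp (-((Δ * Height.logHeight (Fin.cons (1 :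 K) β : Fin (3 + 1) → K) + Y * Module.finrank ℚ K) / c))) : ∀ (ω : Fin 3 → ℂ) (c₁ : ℝ), 1 ≤ c₁ → ∃ δstar : ℕ, 1 ≤ δstar ∧ ∃ K₀ : ℕ, 1 ≤ K₀ ∧ ∃ C₄ : ℝ, c₁ ≤ C₄ ∧ ∃ η : ℝ, 0 < η ∧ ∃ lam : ℝ, 1 ≤ lam ∧ ∃ c : ℝ, c₁ ≤ c ∧ ∀ Δ Y : ℝ, c ≤ Δ → Δ ≤ Y → ∀ (Q : Rx 3) (a : ℕ) (P : Rx 3) (b : ℕ) (𝔮 : Ideal (Rx 3)) (T : Rx 3) (τ : ℕ) (𝔭 𝔮' : Ideal (Rx 3)), CycleAP3Datum ω c₁ Δ (lam * Y) Q a P b 𝔮 T τ 𝔭 → 𝔮'.IsPrime → 𝔮'.IsHomogeneous (homogeneousSubmodule (Fin (3 + 1)) ℚ) → IsUnmixedOfRank 𝔮' 2 → 𝔮' ∈ (Ideal.span {Q} ⊔ Ideal.span {P}).minimalPrimes → Ideal.span {Q} ⊔ Ideal.span {P} ⊔ Ideal.span {T} ≤ 𝔮' → 𝔮' < 𝔭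 → δstar < ideg 𝔮' 2 → a + b + ⌊Δ⌋₊ ≤ τ → Module.finrank ℚ ↥(homogeneousSubmodule (Fin (3 + 1)) ℚ τ) < Module.finrank ℚ ↥(homogeneousSubmodule (Fin (3 + 1)) ℚ τ ⊓ 𝔮'.restrictScalars ℚ) + 2 * ⌊Δ⌋₊ * ideg 𝔮 2 → ⌊c₁ * Δ⌋₊ + 1 < ideg 𝔭 1 → ¬ (Module.finrank ℚ ↥(homogeneousSubmodule (Fin (3 + 1)) ℚ ⌊c₁ * Δ⌋₊) = Module.finrank ℚ ↥(homogeneousSubmodule (Fin (3 + 1)) ℚ ⌊c₁ * Δ⌋₊ ⊓ 𝔭.restrictScalars ℚ) + ideg 𝔭 1) → homogeneousSubmodule (Fin (3 + 1)) ℚ ⌊C₄ * Δ⌋₊ ⊓ 𝔭.restrictScalars ℚ ≤ 𝔮'.restrictScalars ℚ → K₀ * Module.finrank ℚ ↥(homogeneousSubmodule (Fin (3 + 1)) ℚ ⌊C₄ * Δ⌋₊) < ideg 𝔭 1 + K₀ * Module.finrank ℚ ↥(homogeneousSubmodule (Fin (3 + 1)) ℚ ⌊C₄ * Δ⌋₊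 ⊓ 𝔭.restrictScalars ℚ) → (ideg 𝔮' 2 : ℝ) < η * Δ ^ 2 → ∃ (K : Type) (_ : Field K) (_ : NumberField K) (β : Fin 3 → K) (σ : K →+* ℂ), (Module.finrank ℚ K : ℝ) ≤ (c * Δ) ^ 3 ∧ Height.logHeight (Fin.cons (1 : K) β : Fin (3 + 1) → K) ≤ c * Y * Δ ^ 2 ∧ ‖(fun j => σ (β j)) - ω‖ ≤ Real.exp (-((Δ * Height.logHeight (Fin.cons (1 : K) β : Fin (3 + 1) → K) + Y * Module.finrank ℚ K) / c)) := by
  intro ω c₁ hc₁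
  obtain ⟨δstar, hδ, K₀, hK₀, C₄, hC₄, η, hη, M₁, hM₁, lamM, hlamM, cM, hcM, hmid⟩ := hmidLow ω c₁ hc₁
  obtain ⟨lamL, hlamL, cL, hcL, hlow⟩ := pointDatum_or_lowSurface3 ω c₁ hc₁ C₄ hC₄ M₁ hM₁
  have hcM0 : 0 < cM := by linarith
  have hcL0 : 0 < cL := by linarith
  refine ⟨δstar, hδ, K₀, hK₀, C₄, hC₄, η, hη, lamM * lamL, one_le_mul_of_one_le_of_one_le hlamM hlamL,
    max (cM * lamL) (cL * lamM), ?_, ?_⟩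
  · exact le_trans hcM (le_trans (le_mul_of_one_le_right hcM0.le hlamL) (le_max_left _ _))
  intro Δ Y hΔ hY Q a P b 𝔮 T τ 𝔭 𝔮' hdat h1 h2 h3 h4 h5 h6 h7 h8 h9 h10 h11 h12 h13 hcase
  have hcMΔ : cM ≤ Δ := le_trans (le_trans (le_mul_of_one_le_right hcM0.le hlamL) (le_max_left _ _)) hΔ
  have hcLΔ : cL ≤ Δ := le_trans (le_trans (le_mul_of_one_le_right hcL0.le hlamM) (le_max_right _ _)) hΔ
  have hΔ0 : 0 ≤ Δ := by linarith
  have hY0 : 0 ≤ Y := by linarith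
  -- the low-surface dichotomy at the height scale `lamM * Y`
  have hY₁ : Δ ≤ lamM * Y := le_trans hY (le_mul_of_one_le_left hY0 hlamM)
  have hdat₁ : CycleAP3Datum ω c₁ Δ (lamL * (lamM * Y)) Q a P b 𝔮 T τ 𝔭 := by
    rw [show lamL * (lamM * Y) = lamM * lamL * Y by ring]; exact hdat
  rcases hlow Δ (lamM * Y) hcLΔ hY₁ Q a P b 𝔮 T τ 𝔭 𝔮' hdat₁ h1 h3 h6.le h12 with
    ⟨K, iF, iN, β, σ, hd, hh, hacc⟩ | ⟨F, Q₂, d, a₂, hF0, hFhom, hd1, hdM, hFh, hQ₂0, hQ₂hom, ha₂1, ha₂d, hQ₂p, hdvd, hQ₂𝔮'⟩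
  · refine ⟨K, iF, iN, β, σ, ?_, ?_, ?_⟩
    · exact hd.trans (pow_le_pow_left₀ (by positivity)
        (mul_le_mul_of_nonneg_right (le_trans (le_mul_of_one_le_right hcL0.le hlamM) (le_max_right _ _)) hΔ0) 3)
    · calc _ ≤ cL * (lamM * Y) * Δ ^ 2 := hh
        _ = (cL * lamM) * Y * Δ ^ 2 := by ring
        _ ≤ max (cM * lamL) (cL * lamM) * Y * Δ ^ 2 := by gcongr; exact le_max_right _ _
    · exact hacc.trans (exp_datum_mono (Height.logHeight_nonneg _) (Nat.cast_nonneg _) hΔ0 hY0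
        (le_mul_of_one_le_left hY0 hlamM) hcL0
        (le_trans (le_mul_of_one_le_right hcL0.le hlamM) (le_max_right _ _)))
  · -- the mid-low stub at the height scale `lamL * Y`
    have hY₂ : Δ ≤ lamL * Y := le_trans hY (le_mul_of_one_le_left hY0 hlamL)
    have hdat₂ : CycleAP3Datum ω c₁ Δ (lamM * (lamL * Y)) Q a P b 𝔮 T τ 𝔭 := by
      rw [show lamM * (lamL * Y) = lamM * lamL * Y by ring]; exact hdat
    have hFh₂ : height F ≤ lamM * (lamL * Y) / c₁ := by
      rw [show lamM * (lamL * Y) / c₁ = lamL * (lamM * Y) / c₁ by ring]; exact hFh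
    obtain ⟨K, iF, iN, β, σ, hd, hh, hacc⟩ :=
      hmid Δ (lamL * Y) hcMΔ hY₂ Q a P b 𝔮 T τ 𝔭 𝔮' hdat₂ h1 h2 h3 h4 h5 h6 h7 h8 h9 h10 h11 h12 h13 hcase
        ⟨F, Q₂, d, a₂, hF0, hFhom, hd1, hdM, hFh₂, hQ₂0, hQ₂hom, ha₂1, ha₂d, hQ₂p, hdvd, hQ₂𝔮'⟩
    refine ⟨K, iF, iN, β, σ, ?_, ?_, ?_⟩
    · exact hd.trans (pow_le_pow_left₀ (by positivity)
        (mul_le_mul_of_nonneg_right (le_trans (le_mul_of_one_le_right hcM0.le hlamL) (le_max_left _ _)) hΔ0) 3)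
    · calc _ ≤ cM * (lamL * Y) * Δ ^ 2 := hh
        _ = (cM * lamL) * Y * Δ ^ 2 := by ring
        _ ≤ max (cM * lamL) (cL * lamM) * Y * Δ ^ 2 := by gcongr; exact le_max_left _ _
    · exact hacc.trans (exp_datum_mono (Height.logHeight_nonneg _) (Nat.cast_nonneg _) hΔ0 hY0
        (le_mul_of_one_le_left hY0 hlamL) hcM0
        (le_trans (le_mul_of_one_le_right hcM0.le hlamL) (le_max_left _ _)))

/-- **`PointAPAbsAt 3` from the mid-low kernel alone** (landed `pointAPAt3_of_mid` over `midSatellite3_of_midLow`).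
[cite: NesterenkoPhilippon2001, Ch. 4 §4 (p. 61)] -/
theorem pointAPAt3_of_midLow (hmidLow : ∀ (ω : Fin 3 → ℂ) (c₁ : ℝ), 1 ≤ c₁ → ∃ δstar : ℕ, 1 ≤ δstar ∧ ∃ K₀ : ℕ, 1 ≤ K₀ ∧ ∃ C₄ : ℝ, c₁ ≤ C₄ ∧ ∃ η : ℝ, 0 < η ∧ ∃ M₁ : ℝ, 64 * c₁ ≤ M₁ ∧ ∃ lam : ℝ, 1 ≤ lam ∧ ∃ c : ℝ, c₁ ≤ c ∧ ∀ Δ Y : ℝ, c ≤ Δ → Δ ≤ Y → ∀ (Q : Rx 3) (a : ℕ) (P : Rx 3) (b : ℕ) (𝔮 : Ideal (Rx 3)) (T : Rx 3) (τ : ℕ) (𝔭 𝔮' : Ideal (Rx 3)), CycleAP3Datum ω c₁ Δ (lam * Y) Q a P b 𝔮 T τ 𝔭 → 𝔮'.IsPrime → 𝔮'.IsHomogeneous (homogeneousSubmodule (Fin (3 + 1)) ℚ) → IsUnmixedOfRank 𝔮' 2 → 𝔮' ∈ (Ideal.span {Q} ⊔ Ideal.span {P}).minimalPrimes → Ideal.span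 {Q} ⊔ Ideal.span {P} ⊔ Ideal.span {T} ≤ 𝔮' → 𝔮' < 𝔭 → δstar < ideg 𝔮' 2 → a + b + ⌊Δ⌋₊ ≤ τ → Module.finrank ℚ ↥(homogeneousSubmodule (Fin (3 + 1)) ℚ τ) < Module.finrank ℚ ↥(homogeneousSubmodule (Fin (3 + 1)) ℚ τ ⊓ 𝔮'.restrictScalars ℚ) + 2 * ⌊Δ⌋₊ * ideg 𝔮 2 → ⌊c₁ * Δ⌋₊ + 1 < ideg 𝔭 1 → ¬ (Module.finrank ℚ ↥(homogeneousSubmodule (Fin (3 + 1)) ℚ ⌊c₁ * Δ⌋₊) = Module.finrank ℚ ↥(homogeneousSubmodule (Fin (3 + 1)) ℚ ⌊c₁ * Δ⌋₊ ⊓ 𝔭.restrictScalars ℚ) + ideg 𝔭 1) → homogeneousSubmodule (Fin (3 + 1)) ℚ ⌊C₄ * Δ⌋₊ ⊓ 𝔭.restrictScalars ℚ ≤ 𝔮'.restrictScalars ℚ → K₀ * Module.finrank ℚ ↥(homogeneousSubmodule (Fin (3 + 1)) ℚ ⌊C₄ * Δ⌋₊) < ideg 𝔭 1 + K₀ * Module.finrank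 ℚ ↥(homogeneousSubmodule (Fin (3 + 1)) ℚ ⌊C₄ * Δ⌋₊ ⊓ 𝔭.restrictScalars ℚ) → (ideg 𝔮' 2 : ℝ) < η * Δ ^ 2 → (∃ (F Q₂ : Rx 3) (d a₂ : ℕ), F ≠ 0 ∧ F.IsHomogeneous d ∧ 1 ≤ d ∧ (d : ℝ) ≤ Δ / M₁ ∧ height F ≤ lam * Y / c₁ ∧ Q₂ ≠ 0 ∧ Q₂.IsHomogeneous a₂ ∧ 1 ≤ a₂ ∧ a₂ ≤ d ∧ (Ideal.span {Q₂}).IsPrime ∧ Q₂ ∣ F ∧ Q₂ ∈ 𝔮') → ∃ (K : Type) (_ : Field K) (_ : NumberField K) (β : Fin 3 → K) (σ : K →+* ℂ), (Module.finrank ℚ K : ℝ) ≤ (c * Δ) ^ 3 ∧ Height.logHeight (Fin.cons (1 : K) β : Fin (3 + 1) → K) ≤ c * Y * Δ ^ 2 ∧ ‖(fun j => σ (β j)) - ω‖ ≤ Real.exp (-((Δ * Height.logHeight (Fin.cons (1 : K) β : Fin (3 + 1) → K) + Y * Module.finrank ℚ K) / c))) : PointAPAbsAt 3 :=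
  pointAPAt3_of_mid (midSatellite3_of_midLow hmidLow)

/-- **The `t = 3` slice of the crux from the mid-low kernel alone** (landed `slice_three_of_mid`).
[cite: NesterenkoPhilippon2001, Ch. 4 §4 (p. 61)] -/
theorem slice_three_of_midLow (hmidLow : ∀ (ω : Fin 3 → ℂ) (c₁ : ℝ), 1 ≤ c₁ → ∃ δstar : ℕ, 1 ≤ δstar ∧ ∃ K₀ : ℕ, 1 ≤ K₀ ∧ ∃ C₄ : ℝ, c₁ ≤ C₄ ∧ ∃ η : ℝ, 0 < η ∧ ∃ M₁ : ℝ, 64 * c₁ ≤ M₁ ∧ ∃ lam : ℝ, 1 ≤ lam ∧ ∃ c : ℝ, c₁ ≤ c ∧ ∀ Δ Y : ℝ, c ≤ Δ → Δ ≤ Y → ∀ (Q : Rx 3) (a : ℕ) (P : Rx 3) (b : ℕ) (𝔮 : Ideal (Rx 3)) (T : Rx 3) (τ : ℕ) (𝔭 𝔮' : Ideal (Rx 3)), CycleAP3Datum ω c₁ Δ (lam * Y) Q a P b 𝔮 T τ 𝔭 → 𝔮'.IsPrime → 𝔮'.IsHomogeneous (homogeneousSubmodule (Fin (3 + 1)) ℚ)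 → IsUnmixedOfRank 𝔮' 2 → 𝔮' ∈ (Ideal.span {Q} ⊔ Ideal.span {P}).minimalPrimes → Ideal.span {Q} ⊔ Ideal.span {P} ⊔ Ideal.span {T} ≤ 𝔮' → 𝔮' < 𝔭 → δstar < ideg 𝔮' 2 → a + b + ⌊Δ⌋₊ ≤ τ → Module.finrank ℚ ↥(homogeneousSubmodule (Fin (3 + 1)) ℚ τ) < Module.finrank ℚ ↥(homogeneousSubmodule (Fin (3 + 1)) ℚ τ ⊓ 𝔮'.restrictScalars ℚ) + 2 * ⌊Δ⌋₊ * ideg 𝔮 2 → ⌊c₁ * Δ⌋₊ + 1 < ideg 𝔭 1 → ¬ (Module.finrank ℚ ↥(homogeneousSubmodule (Fin (3 + 1)) ℚ ⌊c₁ * Δ⌋₊) = Module.finrank ℚ ↥(homogeneousSubmodule (Fin (3 + 1)) ℚ ⌊c₁ * Δ⌋₊ ⊓ 𝔭.restrictScalars ℚ) + ideg 𝔭 1) → homogeneousSubmodule (Fin (3 + 1)) ℚ ⌊C₄ * Δ⌋₊ ⊓ 𝔭.restrictScalars ℚ ≤ 𝔮'.restrictScalars ℚ → K₀ * Module.finrank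 ℚ ↥(homogeneousSubmodule (Fin (3 + 1)) ℚ ⌊C₄ * Δ⌋₊) < ideg 𝔭 1 + K₀ * Module.finrank ℚ ↥(homogeneousSubmodule (Fin (3 + 1)) ℚ ⌊C₄ * Δ⌋₊ ⊓ 𝔭.restrictScalars ℚ) → (ideg 𝔮' 2 : ℝ) < η * Δ ^ 2 → (∃ (F Q₂ : Rx 3) (d a₂ : ℕ), F ≠ 0 ∧ F.IsHomogeneous d ∧ 1 ≤ d ∧ (d : ℝ) ≤ Δ / M₁ ∧ height F ≤ lam * Y / c₁ ∧ Q₂ ≠ 0 ∧ Q₂.IsHomogeneous a₂ ∧ 1 ≤ a₂ ∧ a₂ ≤ d ∧ (Ideal.span {Q₂}).IsPrime ∧ Q₂ ∣ F ∧ Q₂ ∈ 𝔮') → ∃ (K : Type) (_ : Field K) (_ : NumberField K) (β : Fin 3 → K) (σ : K →+* ℂ), (Module.finrank ℚ K : ℝ) ≤ (c * Δ) ^ 3 ∧ Height.logHeight (Fin.cons (1 : K) β : Fin (3 + 1) → K) ≤ c * Y * Δ ^ 2 ∧ ‖(fun j => σ (β j)) - ω‖ ≤ Real.exp (-((Δ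 * Height.logHeight (Fin.cons (1 : K) β : Fin (3 + 1) → K) + Y * Module.finrank ℚ K) / c))) : PointwiseAPSlice 3 :=
  slice_three_of_mid (midSatellite3_of_midLow hmidLow)

/-- **Registered sub-goal `approximationProperty_of_midLow` — the crux's exact residual after v26**: the mid-low satellite
kernel at `n = 3` (registered open stub `pointDatum_of_midLowSatellite3`) and Philippon's conjecture AP1/AP2 for `n ≥ 4`
(registered open stub `stub_pointAP_four_le`) imply `ApproximationProperty` (landed `approximationProperty_of_mid` over
`midSatellite3_of_midLow`). [cite: NesterenkoPhilippon2001, Ch. 4 §4 (p. 61)] -/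
theorem approximationProperty_of_midLow : (∀ (ω : Fin 3 → ℂ) (c₁ : ℝ), 1 ≤ c₁ → ∃ δstar : ℕ, 1 ≤ δstar ∧ ∃ K₀ : ℕ, 1 ≤ K₀ ∧ ∃ C₄ : ℝ, c₁ ≤ C₄ ∧ ∃ η : ℝ, 0 < η ∧ ∃ M₁ : ℝ, 64 * c₁ ≤ M₁ ∧ ∃ lam : ℝ, 1 ≤ lam ∧ ∃ c : ℝ, c₁ ≤ c ∧ ∀ Δ Y : ℝ, c ≤ Δ → Δ ≤ Y → ∀ (Q : Rx 3) (a : ℕ) (P : Rx 3) (b : ℕ) (𝔮 : Ideal (Rx 3)) (T : Rx 3) (τ : ℕ) (𝔭 𝔮' : Ideal (Rx 3)), CycleAP3Datum ω c₁ Δ (lam * Y) Q a P b 𝔮 T τ 𝔭 → 𝔮'.IsPrime → 𝔮'.IsHomogeneous (homogeneousSubmodule (Fin (3 + 1)) ℚ) → IsUnmixedOfRank 𝔮' 2 → 𝔮' ∈ (Ideal.span {Q} ⊔ Ideal.span {P}).minimalPrimes → Ideal.span {Q} ⊔ Ideal.span {P} ⊔ Ideal.span {T} ≤ 𝔮' →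 𝔮' < 𝔭 → δstar < ideg 𝔮' 2 → a + b + ⌊Δ⌋₊ ≤ τ → Module.finrank ℚ ↥(homogeneousSubmodule (Fin (3 + 1)) ℚ τ) < Module.finrank ℚ ↥(homogeneousSubmodule (Fin (3 + 1)) ℚ τ ⊓ 𝔮'.restrictScalars ℚ) + 2 * ⌊Δ⌋₊ * ideg 𝔮 2 → ⌊c₁ * Δ⌋₊ + 1 < ideg 𝔭 1 → ¬ (Module.finrank ℚ ↥(homogeneousSubmodule (Fin (3 + 1)) ℚ ⌊c₁ * Δ⌋₊) = Module.finrank ℚ ↥(homogeneousSubmodule (Fin (3 + 1)) ℚ ⌊c₁ * Δ⌋₊ ⊓ 𝔭.restrictScalars ℚ) + ideg 𝔭 1) → homogeneousSubmodule (Fin (3 + 1)) ℚ ⌊C₄ * Δ⌋₊ ⊓ 𝔭.restrictScalars ℚ ≤ 𝔮'.restrictScalars ℚ → K₀ * Module.finrank ℚ ↥(homogeneousSubmodule (Fin (3 + 1)) ℚ ⌊C₄ * Δ⌋₊) < ideg 𝔭 1 + K₀ * Module.finrank ℚ ↥(homogeneousSubmodule (Fin (3 + 1)) ℚ ⌊C₄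 * Δ⌋₊ ⊓ 𝔭.restrictScalars ℚ) → (ideg 𝔮' 2 : ℝ) < η * Δ ^ 2 → (∃ (F Q₂ : Rx 3) (d a₂ : ℕ), F ≠ 0 ∧ F.IsHomogeneous d ∧ 1 ≤ d ∧ (d : ℝ) ≤ Δ / M₁ ∧ height F ≤ lam * Y / c₁ ∧ Q₂ ≠ 0 ∧ Q₂.IsHomogeneous a₂ ∧ 1 ≤ a₂ ∧ a₂ ≤ d ∧ (Ideal.span {Q₂}).IsPrime ∧ Q₂ ∣ F ∧ Q₂ ∈ 𝔮') → ∃ (K : Type) (_ : Field K) (_ : NumberField K) (β : Fin 3 → K) (σ : K →+* ℂ), (Module.finrank ℚ K : ℝ) ≤ (c * Δ) ^ 3 ∧ Height.logHeight (Fin.cons (1 : K) β : Fin (3 + 1) → K) ≤ c * Y * Δ ^ 2 ∧ ‖(fun j => σ (β j)) - ω‖ ≤ Real.exp (-((Δ * Height.logHeight (Fin.cons (1 : K) β : Fin (3 + 1) → K) + Y * Module.finrank ℚ K) / c))) → (∀ t : ℕ, 4 ≤ t → PointAPAbsAt t) → ApproximationProperty :=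
  fun hmidLow h4 => approximationProperty_of_mid (midSatellite3_of_midLow hmidLow) h4

end Summit.Schanuel.Schanuel.Cruxes.ApproximationProperty.OrbitInterpolationDeterminant

end
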